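import Mathlib

/-!
# A2Projection — the sign bookkeeping of the projection formula for Gysin maps

Kernel-checked form of the computation in Lemma A4.1.1 (i) of route/T4-A2-p6.md (sub-claim A2
of route/TIER4.md, cell pub-hodge-repro2).  Setting (abstracted): `A = H^*(X)` and
`B = H^*(Y)` are rings (cup product), `HX`, `HY` are modules over them (cap product: the module
axioms are Bredon Thm. 5.2 (1) and (3)), `gpull : A →+* B` is `g^*`, `HY` is an `A`-module
through `gpull`, and `ghom : HY → HX` is `A`-linear — that is Bredon Thm. 5.2 (4),
`g_*(g^*(α) ∩ β) = α ∩ g_*(β)`.  Poincaré duality is the injectivity of `a ↦ a • μX`.  The Gysin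
map of a class `α` is the unique `gysin α` with `gysin α • μX = ghom (α • μY)`.

Graded commutativity enters exactly twice, for the two pairs of homogeneous classes that the
proof swaps: `α * g^*v = ε₁ • (g^*v * α)` and `v * gysin α = ε₂ • (gysin α * v)` with signs
`ε₁ = (-1)^{ab}`, `ε₂ = (-1)^{b(a + 2d)}`, whose product is `+1` because `deg (gysin α) ≡ deg α
(mod 2)`.  The theorem takes the two commutation identities as hypotheses (the graded structure
itself is not formalised) and proves `gysin (α * g^*v) = gysin α * v` — no sign survives.
-/

namespace Summit.Ventures.HodgeRepro2.A2Projection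

variable {A B HX HY : Type*} [Ring A] [Ring B] [AddCommGroup HX] [AddCommGroup HY]
  [Module A HX] [Module B HY]

/-- The product of the two Koszul signs of Lemma A4.1.1 is `+1`: the exponents `a*b` and
`b*(a + 2*d)` have the same parity. -/
theorem sign_product (a b d : ℕ) : ((-1 : ℤ) ^ (a * b)) * ((-1 : ℤ) ^ (b * (a + 2 * d))) = 1 := by
  rw [← pow_add]
  apply Even.neg_one_pow
  refine ⟨a * b + b * d, ?_⟩
  ring

/-- **Projection formula, sign-free** (Lemma A4.1.1 (i)).  Let `gpull : A →+* B` be the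
pull-back, `ghom : HY → HX` additive and `A`-linear through `gpull`
(`ghom (gpull v • h) = v • ghom h`), `μX`, `μY` the fundamental classes with `a ↦ a • μX`
injective (Poincaré duality on `X`), and `gysin` a map with `gysin α • μX = ghom (α • μY)` for
all `α`.  If the homogeneous classes `α` (degree `a`) and `v` (degree `b`) satisfy the two
graded-commutativity identities with `deg (gysin α) = a + 2 d`, then
`gysin (α * gpull v) = gysin α * v`. -/
theorem gysin_mul_pull {gpull : A →+* B} {ghom : HY →+ HX} {μX : HX} {μY : HY}
    (hlin : ∀ (v : A) (h : HY), ghom (gpull v • h) = v • ghom h)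
    (hPD : Function.Injective (fun a : A => a • μX))
    {gysin : B → A} (hgysin : ∀ β : B, gysin β • μX = ghom (β • μY))
    (α : B) (v : A) (a b d : ℕ)
    (hcomm1 : α * gpull v = ((-1 : ℤ) ^ (a * b)) • (gpull v * α))
    (hcomm2 : v * gysin α = ((-1 : ℤ) ^ (b * (a + 2 * d))) • (gysin α * v)) :
    gysin (α * gpull v) = gysin α * v := by
  apply hPD
  show gysin (α * gpull v) • μX = (gysin α * v) • μX
  calc gysin (α * gpull v) • μX
      = ghom ((α * gpull v) • μY) := hgysin _
    _ = ghom ((((-1 : ℤ) ^ (a * b)) • (gpull v * α)) • μY) := by rw [hcomm1]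
    _ = ((-1 : ℤ) ^ (a * b)) • ghom ((gpull v * α) • μY) := by
          rw [smul_assoc, map_zsmul]
    _ = ((-1 : ℤ) ^ (a * b)) • ghom (gpull v • (α • μY)) := by rw [mul_smul]
    _ = ((-1 : ℤ) ^ (a * b)) • (v • ghom (α • μY)) := by rw [hlin]
    _ = ((-1 : ℤ) ^ (a * b)) • (v • (gysin α • μX)) := by rw [hgysin]
    _ = ((-1 : ℤ) ^ (a * b)) • ((v * gysin α) • μX) := by rw [mul_smul]
    _ = ((-1 : ℤ) ^ (a * b)) • ((((-1 : ℤ) ^ (b * (a + 2 * d))) • (gysin α * v)) • μX) := by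
          rw [hcomm2]
    _ = (((-1 : ℤ) ^ (a * b)) * ((-1 : ℤ) ^ (b * (a + 2 * d)))) • ((gysin α * v) • μX) := by
          rw [smul_assoc, smul_smul]
    _ = (gysin α * v) • μX := by rw [sign_product, one_smul]

end Summit.Ventures.HodgeRepro2.A2Projection
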